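import Mathlib
import Summits.Ventures.PercRepro.PuncturedLYMCapTable

/-!
# PercRepro — THE VALUE-BLOCK PIPELINE ON COUNTS: ADMISSIBILITY FROM THE NUMBERS (K, f) ALONE
(p10, gen 42)

By the symmetry of a pairwise disjoint family of `m`-sets, a stage of the value-block recursion is determined by the
number `K` of its members and the number `f` of its free points.  `CountOK m tab w K f l a γ R` is the admissibility
predicate on these numbers (the table `tab K f l w a γ c`; the block of size `c` hands down `K − c`, the same `f`,
`l − w·c`, `a·(1 − β c)`, `γ' c`, `R − γ·c`).  **`capOK_of_countOK`**: for pairwise disjoint members of size `m` on `S`,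
`CountOK` at `K = #𝒞`, `f = #(S ∖ ⋃𝒞)` gives `CapOK` for the table read through the counts — the free points of a block's
inner stage are the free points of the stage (`sdiff_blockUnion_sdiff`), and the inner family has `K − #B` members.
**`puncturedNMP_of_countOK`**: (SP) of a pairwise disjoint family of `k` members of size `m` on a type of `n` points from
`CountOK` at `(k, n − m·k)` — so a certificate uniform in `(n, k)` is a proof of `CountOK` for the symbolic table of the
pattern, a bounded tree of rational inequalities and identities in `(k, f)` (paper proofs/P10-PEEL-g42.md §5).  Nothing here
asserts (SP).  (Refresh: byte-identical declarations; re-filed for the olean build.)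
-/

namespace PercRepro.PuncturedLYM.Split.Peel

open Finset

variable {α : Type} [DecidableEq α]

/-- The admissibility of a table on counts along the value-block recursion. -/
def CountOK (m : ℕ) (tab : ℕ → ℕ → ℕ → ℕ → ℚ → ℚ → ℕ → ℚ) :
    ℕ → ℕ → ℕ → ℕ → ℚ → ℚ → ℚ → Prop
  | 0, K, f, l, a, γ, R => R = a * ((f - l : ℕ) : ℚ) / ((l : ℚ) + 1) + γ * K
  | w + 1, K, f, l, a, γ, R =>
      tab K f l (w + 1) a γ 0 = 0 ∧ (∀ c, 0 ≤ tab K f l (w + 1) a γ c ∧ tab K f l (w + 1) a γ c ≤ 1) ∧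
      (∀ c, (w + 1) * c = l + 1 → tab K f l (w + 1) a γ c = 1) ∧
      ∀ c, c ≤ K → (w + 1) * c ≤ l →
        CountOK m tab w (K - c) f (l - (w + 1) * c) (a * (1 - tab K f l (w + 1) a γ c))
          (((m : ℚ) - (w + 1 : ℕ) + 1) * a * tab K f l (w + 1) a γ (c + 1) / (((c : ℚ) + 1) * (w + 1 : ℕ)))
          (R - γ * c)

/-- The table on sets read through the counts. -/
def tableOfCounts (tab : ℕ → ℕ → ℕ → ℕ → ℚ → ℚ → ℕ → ℚ) :
    Finset α → Finset (Finset α) → ℕ → ℕ → ℚ → ℚ → ℕ → ℚ :=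
  fun S 𝒞 l w a γ c => tab 𝒞.card (S \ blockUnion 𝒞).card l w a γ c

/-- The union of a family splits along a sub-family. -/
theorem blockUnion_union_sdiff {𝒞 B : Finset (Finset α)} (hB : B ⊆ 𝒞) :
    blockUnion B ∪ blockUnion (𝒞 \ B) = blockUnion 𝒞 := by
  ext y
  rw [mem_union, mem_blockUnion, mem_blockUnion, mem_blockUnion]
  constructor
  · rintro (⟨C, hC, hy⟩ | ⟨C, hC, hy⟩)
    · exact ⟨C, hB hC, hy⟩
    · exact ⟨C, (mem_sdiff.1 hC).1, hy⟩
  · rintro ⟨C, hC, hy⟩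
    by_cases hCB : C ∈ B
    · exact Or.inl ⟨C, hCB, hy⟩
    · exact Or.inr ⟨C, mem_sdiff.2 ⟨hC, hCB⟩, hy⟩

/-- The free points of a block's inner stage are the free points of the stage. -/
theorem sdiff_blockUnion_sdiff {S : Finset α} {𝒞 B : Finset (Finset α)} (hB : B ⊆ 𝒞) :
    (S \ blockUnion B) \ blockUnion (𝒞 \ B) = S \ blockUnion 𝒞 := by
  rw [sdiff_sdiff]
  show S \ (blockUnion B ∪ blockUnion (𝒞 \ B)) = S \ blockUnion 𝒞
  rw [blockUnion_union_sdiff hB]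

/-- **ADMISSIBILITY ON SETS FROM ADMISSIBILITY ON COUNTS.** -/
theorem capOK_of_countOK {m : ℕ} (tab : ℕ → ℕ → ℕ → ℕ → ℚ → ℚ → ℕ → ℚ) :
    ∀ (w : ℕ) (S : Finset α) (𝒞 : Finset (Finset α)) (l : ℕ) (a γ R : ℚ),
      (∀ C ∈ 𝒞, C ⊆ S) → (∀ C ∈ 𝒞, C.card = m) → (∀ C ∈ 𝒞, ∀ C' ∈ 𝒞, C ≠ C' → Disjoint C C') →
      CountOK m tab w 𝒞.card (S \ blockUnion 𝒞).card l a γ R →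
      CapOK m (tableOfCounts tab) w S 𝒞 l a γ R := by
  intro w
  induction w with
  | zero =>
    intro S 𝒞 l a γ R _ _ _ hok
    exact hok
  | succ w ih =>
    intro S 𝒞 l a γ R h𝒞S hcard hdisj hok
    obtain ⟨h0, hβ, htop, hinner⟩ := hok
    refine ⟨h0, hβ, htop, ?_⟩
    intro B hB hBl
    have hcardB : (𝒞 \ B).card = 𝒞.card - B.card := card_sdiff_of_subset hB
    have hfree : ((S \ blockUnion B) \ blockUnion (𝒞 \ B)).card = (S \ blockUnion 𝒞).card := by
      rw [sdiff_blockUnion_sdiff hB]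
    have hcount := hinner B.card (card_le_card hB) hBl
    have hih := ih (S \ blockUnion B) (𝒞 \ B) (l - (w + 1) * B.card)
      (a * (1 - tab 𝒞.card (S \ blockUnion 𝒞).card l (w + 1) a γ B.card))
      (((m : ℚ) - (w + 1 : ℕ) + 1) * a * tab 𝒞.card (S \ blockUnion 𝒞).card l (w + 1) a γ (B.card + 1)
        / (((B.card : ℚ) + 1) * (w + 1 : ℕ)))
      (R - γ * B.card)
      (fun C hC => subset_sdiff.2 ⟨h𝒞S C (mem_sdiff.1 hC).1,
        disjoint_blockUnion_of_notMem hdisj hB (mem_sdiff.1 hC).1 (mem_sdiff.1 hC).2⟩)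
      (fun C hC => hcard C (mem_sdiff.1 hC).1)
      (fun C hC C' hC' hne => hdisj C (mem_sdiff.1 hC).1 C' (mem_sdiff.1 hC').1 hne)
      (by rw [hcardB, hfree]; exact hcount)
    exact hih

/-- **(SP) OF A PAIRWISE DISJOINT FAMILY FROM ADMISSIBILITY ON COUNTS.** `k` members of size `m` on a type of `n` points,
`n − m·k` free points. -/
theorem puncturedNMP_of_countOK [Fintype α] {m : ℕ} (tab : ℕ → ℕ → ℕ → ℕ → ℚ → ℚ → ℕ → ℚ)
    {k : ℕ} (C : Fin k → Finset α) (hm : 0 < m) (hcard : ∀ i, (C i).card = m)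
    (hdisj : ∀ i j, i ≠ j → Disjoint (C i) (C j)) {l : ℕ} (hl : l + 1 < 2 * m) {R : ℚ}
    (hok : CountOK m tab (m - 1) k (Fintype.card α - m * k) l 1 (1 / (m : ℚ)) R) :
    PuncturedNMP l ((univ : Finset (Fin k)).biUnion (fun i => upLevel l (C i))) := by
  set 𝒞 := (univ : Finset (Fin k)).image C with h𝒞
  have hinj : Function.Injective C := by
    intro i j hij
    by_contra hne
    have hd := hdisj i j hne
    rw [hij, disjoint_self] at hd
    have := hcard j
    rw [hd] at this
    simp only [Finset.bot_eq_empty, card_empty] at this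
    omega
  have hcard' : ∀ C' ∈ 𝒞, C'.card = m := by
    intro C' hC'
    obtain ⟨i, _, rfl⟩ := mem_image.1 hC'
    exact hcard i
  have hdisj' : ∀ C' ∈ 𝒞, ∀ C'' ∈ 𝒞, C' ≠ C'' → Disjoint C' C'' := by
    intro C' hC' C'' hC'' hne
    obtain ⟨i, _, rfl⟩ := mem_image.1 hC'
    obtain ⟨j, _, rfl⟩ := mem_image.1 hC''
    exact hdisj i j (fun h => hne (h ▸ rfl))
  have hK : 𝒞.card = k := by
    rw [h𝒞, card_image_of_injective _ hinj, card_univ, Fintype.card_fin]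
  have hf : ((univ : Finset α) \ blockUnion 𝒞).card = Fintype.card α - m * k := by
    rw [card_sdiff_of_subset (subset_univ _), card_univ]
    congr 1
    unfold blockUnion
    rw [card_biUnion]
    · rw [sum_congr rfl (fun C' hC' => show (id C').card = m from hcard' C' hC'), sum_const, hK, smul_eq_mul,
        Nat.mul_comm]
    · intro C' hC' C'' hC'' hne
      exact hdisj' C' hC' C'' hC'' hne
  apply puncturedNMP_of_ok (tableOfCounts tab) C hm hcard hdisj hl
  apply capOK_of_countOK tab (m - 1) univ 𝒞 l 1 (1 / (m : ℚ)) R (fun _ _ => subset_univ _) hcard' hdisj'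
  rw [hK, hf]
  exact hok

end PercRepro.PuncturedLYM.Split.Peel
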